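import Summits.RiemannHypothesis.RiemannHypothesis.Theorems.HandoffLowerSlopeStatus
import HarnessLib

/-!
# Window domination laws, II: the scalar shadow and its RH-free ceiling (slope `2`)

TRACK «HANDOFF», seat handoff-theory-1 (H-T, statement owner), file XXI-b, companion of
`HandoffDominationStatus.lean` (XXI-a: a window domination law `DOM(Φ, λ₀) : ∀ λ ≥ λ₀, ∀ g (Weil test,
tsupport g ⊆ [-log λ, log λ]), Φ λ g ≤ Re Q(g)` with `Φ ≥ 0` is EXACTLY `RH ∧` its zero-side form; the
idea-1 lens's (PL) PROLATE DOMINATION, IDEAS-prolate §100, is the instance `Φ λ g = κλ^{-A}L_λ(g)`).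
Sorry-free, standard axioms, no definitions, no new analysis — bookkeeping on tree theorems
(`le_weilGroundEnergy_of_forall`, the RH-free doubly-exponential thinness
`weilGroundEnergy_exp_exp_decay`, the a-priori bound `weilGroundEnergy_le_const`, file XVII
`HandoffLowerSlopeStatus`).  This file does not import XXI-a.

* §4.1 `le_weilGroundEnergy_of_windowDomination` — THE SCALAR SHADOW: a domination law at a window
  `λ > 1` with a FLOOR `φ‖g‖₂² ≤ Φ λ g` gives the lower size law `φ ≤ ε(log λ)` for the Weil ground
  energy; `le_weilGroundEnergy_of_windowFloor` — the same for a floor law read on `Re Q` directly.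
* §4.2 RH-FREE CEILING: `not_windowFloor_of_lt_two` — for `s < 2` NO floor law `exp(-Cλ^s)‖g‖₂² ≤ Re Q(g)`
  (`λ ≥ λ₀`) holds, whatever `C, λ₀` (it would contradict `ε(a) ≤ C' e^{-c e^{2a}}`);
  `exists_rate_not_windowFloor_sq` — at `s = 2` the constant `C` cannot undercut the tree's rate `c`.
* §4.3 `signAware_two_of_windowFloor_sq` — a Gaussian-in-`λ` floor `κλ^{-B}e^{-Cλ²}` (`κ > 0`) gives the
  SIGN-AWARE lower slope law of file XVII with slope `2`; hence
  `riemannHypothesis_and_lowerSlope_two_of_windowFloor_sq`: such a law is `RH ∧ bare(2)` — slope EXACTLY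
  `2`, the edge of XVII's table (`not_signAware_lowerSlope_of_lt_two` kills every slope `< 2`; past the
  absolute slope `A` the law would be RH verbatim).

READING for (PL): with idea-1's leakage floor `L_λ(g) ≥ (1 − λ₀(2πλ²))‖g‖²/(4λ²)` (§100.1, DERIVED)
and Slepian's `1 − λ₀(c) ≍ √c e^{-2c}` (Fuchs 1964, print; neither is in the tree) the scalar shadow of
(PL) is a Gaussian floor with `C = 4π`: (PL) sits at slope EXACTLY `2` — `≥ RH`, refutable RH-free only
by a window direction of Weil energy below the Slepian floor (a decay rate `c > 4π`), derivable from RH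
only together with a slope-`2` lower size law (the tree's RH-world law has slope `A`).  A floor decaying
faster than Gaussian in `λ` is impossible outright (§4.2).  Nothing here bears on the truth of RH.
-/

noncomputable section

set_option linter.dupNamespace false  -- the mandated namespace repeats `RiemannHypothesis`

open Filter Topology Set Literature.NumberTheory.LFunctions

namespace Summit.RiemannHypothesis.RiemannHypothesis.Theorems.HandoffDomination

open Summit.RiemannHypothesis.RiemannHypothesis.Theorems

/-! ## §4  The scalar shadow of a domination law, and its RH-free ceiling -/

section Scalar

variable {Φ : ℝ → (ℝ → ℂ) → ℝ}

/-- **THE SCALAR SHADOW.**  A domination law at one window `λ > 1` together with a FLOOR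
`φ·‖g‖₂² ≤ Φ λ g` on that window gives the lower size law `φ ≤ ε(log λ)` for the Weil ground
energy (`le_weilGroundEnergy_of_forall`: a bound on the unit sphere bounds the infimum).  For (PL)
idea-1's §100.1 supplies the floor `φ(λ) = κλ^{-A-2}(1 − λ₀(2πλ²))/4`. -/
theorem le_weilGroundEnergy_of_windowDomination {lam φ : ℝ} (hlam : 1 < lam)
    (hdom : ∀ g : ℝ → ℂ, IsWeilTest g → tsupport g ⊆ Icc (-Real.log lam) (Real.log lam) →
      Φ lam g ≤ (weilQuadratic g).re)
    (hfloor : ∀ g : ℝ → ℂ, IsWeilTest g → tsupport g ⊆ Icc (-Real.log lam) (Real.log lam) →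
      φ * ∫ t : ℝ, ‖g t‖ ^ 2 ≤ Φ lam g) :
    φ ≤ weilGroundEnergy (Real.log lam) := by
  refine le_weilGroundEnergy_of_forall (Real.log_pos hlam) fun h hh hs hn ↦ ?_
  have h1 := hfloor h hh hs
  rw [hn, mul_one] at h1
  exact h1.trans (hdom h hh hs)

/-- A window floor law read on Weil's form directly — `φ(λ)‖g‖₂² ≤ Re Q(g)` on `[-log λ, log λ]`
for `λ ≥ λ₀` — gives `φ(λ) ≤ ε(log λ)` for every `λ ≥ max λ₀ 2`. -/
theorem le_weilGroundEnergy_of_windowFloor {φ : ℝ → ℝ} {lam₀ : ℝ}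
    (h : ∀ lam : ℝ, lam₀ ≤ lam → ∀ g : ℝ → ℂ, IsWeilTest g →
      tsupport g ⊆ Icc (-Real.log lam) (Real.log lam) →
        φ lam * ∫ t : ℝ, ‖g t‖ ^ 2 ≤ (weilQuadratic g).re)
    {lam : ℝ} (hlam : max lam₀ 2 ≤ lam) : φ lam ≤ weilGroundEnergy (Real.log lam) := by
  have hlam₀ : lam₀ ≤ lam := le_trans (le_max_left _ _) hlam
  have hlam1 : 1 < lam := lt_of_lt_of_le (by norm_num) (le_trans (le_max_right _ _) hlam)
  exact le_weilGroundEnergy_of_windowDomination (Φ := fun lam g ↦ φ lam * ∫ t : ℝ, ‖g t‖ ^ 2)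
    hlam1 (h lam hlam₀) fun _ _ _ ↦ le_rfl

/-- Bookkeeping: `exp(-u) ≤ C'·exp(-v)` forces `v − u < log (max C' 1) + 1`. -/
theorem sub_lt_of_exp_neg_le {u v C' : ℝ} (h : Real.exp (-u) ≤ C' * Real.exp (-v)) :
    v - u < Real.log (max C' 1) + 1 := by
  by_contra hcon
  push Not at hcon
  have hexp : Real.exp (v - u) ≤ C' :=
    calc Real.exp (v - u) = Real.exp v * Real.exp (-u) := by rw [sub_eq_add_neg, Real.exp_add]
      _ ≤ Real.exp v * (C' * Real.exp (-v)) := mul_le_mul_of_nonneg_left h (Real.exp_pos _).le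
      _ = C' := by
          rw [mul_left_comm, ← Real.exp_add, add_neg_cancel, Real.exp_zero, mul_one]
  have hlt : max C' 1 < Real.exp (v - u) :=
    calc max C' 1 = Real.exp (Real.log (max C' 1)) :=
          (Real.exp_log (lt_of_lt_of_le one_pos (le_max_right _ _))).symm
      _ < Real.exp (Real.log (max C' 1) + 1) := Real.exp_lt_exp.2 (by linarith)
      _ ≤ Real.exp (v - u) := Real.exp_le_exp.2 hcon
  linarith [le_max_left C' 1]

/-- Bookkeeping for the windows `λ ≥ max λ₀ e`: the tree's RH-free upper law at `a = log λ` reads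
`ε(log λ) ≤ C'·exp(-c λ²)`. -/
theorem weilGroundEnergy_log_le_of_decay {c C' lam : ℝ}
    (hC' : ∀ a : ℝ, 1 ≤ a → weilGroundEnergy a ≤ C' * Real.exp (-c * Real.exp (2 * a)))
    (hlam : Real.exp 1 ≤ lam) :
    weilGroundEnergy (Real.log lam) ≤ C' * Real.exp (-c * lam ^ 2) := by
  have hlampos : 0 < lam := lt_of_lt_of_le (Real.exp_pos 1) hlam
  have hlog1 : 1 ≤ Real.log lam := by
    rw [← Real.log_exp 1]
    exact Real.log_le_log (Real.exp_pos 1) hlam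
  have := hC' (Real.log lam) hlog1
  rwa [show Real.exp (2 * Real.log lam) = lam ^ 2 by
    rw [show (2 : ℝ) * Real.log lam = Real.log lam + Real.log lam by ring, Real.exp_add,
      Real.exp_log hlampos, sq]] at this

/-- **RH-FREE CEILING ON FLOORS, I: no sub-Gaussian floor.**  For every `s < 2` and all constants
`C, λ₀`, the window floor law `exp(-C λ^s)·‖g‖₂² ≤ Re Q(g)` (tests on `[-log λ, log λ]`, `λ ≥ λ₀`)
is FALSE: it would give `ε(log λ) ≥ exp(-C λ^s)`, against the tree's unconditional upper law
`ε(a) ≤ C' exp(-c e^{2a}) = C' exp(-c λ²)`, `c > 0` (`weilGroundEnergy_exp_exp_decay`: the Weil ground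
state is doubly-exponentially thin).  Hence a domination law `DOM(Φ)` whose functional has such a
floor is false outright, RH or not. -/
theorem not_windowFloor_of_lt_two {s C lam₀ : ℝ} (hs : s < 2) :
    ¬ ∀ lam : ℝ, lam₀ ≤ lam → ∀ g : ℝ → ℂ, IsWeilTest g →
        tsupport g ⊆ Icc (-Real.log lam) (Real.log lam) →
          Real.exp (-C * lam ^ s) * ∫ t : ℝ, ‖g t‖ ^ 2 ≤ (weilQuadratic g).re := by
  intro h
  obtain ⟨c, hc, C', hC'⟩ := weilGroundEnergy_exp_exp_decay
  -- (i) eventually `|C|·λ^{-(2-s)} < c/2`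
  have h1 : ∀ᶠ lam : ℝ in atTop, |C| * lam ^ (-(2 - s)) < c / 2 := by
    have ht : Tendsto (fun lam : ℝ ↦ |C| * lam ^ (-(2 - s))) atTop (𝓝 (|C| * 0)) :=
      (tendsto_rpow_neg_atTop (by linarith : 0 < 2 - s)).const_mul |C|
    rw [mul_zero] at ht
    exact (tendsto_order.1 ht).2 _ (by linarith)
  -- (ii) eventually `(c/2)·λ² ≥ log (max C' 1) + 1`
  have h2 : ∀ᶠ lam : ℝ in atTop, Real.log (max C' 1) + 1 ≤ c / 2 * lam ^ 2 :=
    ((tendsto_pow_atTop two_ne_zero).const_mul_atTop (by linarith : 0 < c / 2)).eventually_ge_atTop _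
  -- (iii) eventually the window is admissible
  have h3 : ∀ᶠ lam : ℝ in atTop, max lam₀ (Real.exp 1) ≤ lam := eventually_ge_atTop _
  obtain ⟨lam, hl1, hl2, hl3⟩ := (h1.and (h2.and h3)).exists
  have hlam₀ : lam₀ ≤ lam := le_trans (le_max_left _ _) hl3
  have hlame : Real.exp 1 ≤ lam := le_trans (le_max_right _ _) hl3
  have hlam2 : (2 : ℝ) ≤ lam := le_trans (by linarith [Real.add_one_le_exp (1 : ℝ)]) hlame
  have hlampos : 0 < lam := by linarith
  -- floor and ceiling at this window
  have hlow : Real.exp (-C * lam ^ s) ≤ weilGroundEnergy (Real.log lam) :=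
    le_weilGroundEnergy_of_windowFloor (φ := fun lam ↦ Real.exp (-C * lam ^ s)) h
      (max_le hlam₀ hlam2)
  have hup : weilGroundEnergy (Real.log lam) ≤ C' * Real.exp (-c * lam ^ 2) :=
    weilGroundEnergy_log_le_of_decay hC' hlame
  have hchain := hlow.trans hup
  rw [neg_mul, neg_mul] at hchain
  have hlt := sub_lt_of_exp_neg_le hchain
  -- `C·λ^s ≤ (c/2)·λ²`
  have hsplit : lam ^ s = lam ^ 2 * lam ^ (-(2 - s)) := by
    rw [← Real.rpow_two, ← Real.rpow_add hlampos]
    congr 1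
    ring
  have hpow : C * lam ^ s ≤ c / 2 * lam ^ 2 := by
    have hnn : 0 ≤ lam ^ 2 * lam ^ (-(2 - s)) := by positivity
    calc C * lam ^ s ≤ |C| * lam ^ s := by
          rw [hsplit]; exact mul_le_mul_of_nonneg_right (le_abs_self C) hnn
      _ = (|C| * lam ^ (-(2 - s))) * lam ^ 2 := by rw [hsplit]; ring
      _ ≤ (c / 2) * lam ^ 2 := mul_le_mul_of_nonneg_right hl1.le (by positivity)
  linarith

/-- **RH-FREE CEILING ON FLOORS, II: at the Gaussian scale the constant is bounded below.**  There is
an absolute `c > 0` (the rate of `weilGroundEnergy_exp_exp_decay`) such that NO window floor law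
`exp(-C λ²)·‖g‖₂² ≤ Re Q(g)` with `C < c` holds, for any `λ₀`.  For (PL), whose floor is
`≍ λ^{-B} e^{-4πλ²}` (idea-1 §100.1 with Slepian's asymptotics), this is the only RH-free constraint
the tree places on it: a refutation of (PL) from this side would need a decay rate `c > 4π`, i.e. a
window direction of Weil energy below the Slepian floor. -/
theorem exists_rate_not_windowFloor_sq :
    ∃ c : ℝ, 0 < c ∧ ∀ C : ℝ, C < c → ∀ lam₀ : ℝ,
      ¬ ∀ lam : ℝ, lam₀ ≤ lam → ∀ g : ℝ → ℂ, IsWeilTest g →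
          tsupport g ⊆ Icc (-Real.log lam) (Real.log lam) →
            Real.exp (-C * lam ^ 2) * ∫ t : ℝ, ‖g t‖ ^ 2 ≤ (weilQuadratic g).re := by
  obtain ⟨c, hc, C', hC'⟩ := weilGroundEnergy_exp_exp_decay
  refine ⟨c, hc, fun C hC lam₀ h ↦ ?_⟩
  have h2 : ∀ᶠ lam : ℝ in atTop, Real.log (max C' 1) + 1 ≤ (c - C) * lam ^ 2 :=
    ((tendsto_pow_atTop two_ne_zero).const_mul_atTop (by linarith : 0 < c - C)).eventually_ge_atTop _
  have h3 : ∀ᶠ lam : ℝ in atTop, max lam₀ (Real.exp 1) ≤ lam := eventually_ge_atTop _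
  obtain ⟨lam, hl2, hl3⟩ := (h2.and h3).exists
  have hlam₀ : lam₀ ≤ lam := le_trans (le_max_left _ _) hl3
  have hlame : Real.exp 1 ≤ lam := le_trans (le_max_right _ _) hl3
  have hlam2 : (2 : ℝ) ≤ lam := le_trans (by linarith [Real.add_one_le_exp (1 : ℝ)]) hlame
  have hlow : Real.exp (-C * lam ^ 2) ≤ weilGroundEnergy (Real.log lam) :=
    le_weilGroundEnergy_of_windowFloor (φ := fun lam ↦ Real.exp (-C * lam ^ 2)) h
      (max_le hlam₀ hlam2)
  have hup : weilGroundEnergy (Real.log lam) ≤ C' * Real.exp (-c * lam ^ 2) :=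
    weilGroundEnergy_log_le_of_decay hC' hlame
  have hchain := hlow.trans hup
  rw [neg_mul, neg_mul] at hchain
  have hlt := sub_lt_of_exp_neg_le hchain
  have : (c - C) * lam ^ 2 = c * lam ^ 2 - C * lam ^ 2 := by ring
  linarith

/-- **A GAUSSIAN-IN-`λ` FLOOR PUTS THE LAW AT SLOPE EXACTLY `2`.**  If a window law with floor
`κ λ^{-B} e^{-C λ²}·‖g‖₂² ≤ Re Q(g)` (`κ > 0`; tests on `[-log λ, log λ]`, `λ ≥ λ₀`) holds, then the
SIGN-AWARE lower slope law of file XVII holds with slope `2`: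
`∃ K a₀, ∀ a ≥ a₀, 0 < ε(a) ∧ log (log (ε a)⁻¹) ≤ 2a + K`.
(At `a = log λ`: `ε(a) ≥ κ e^{-Ba} e^{-C e^{2a}} > 0`, and with the tree's a-priori `ε(a) ≤ B₀` the inner
logarithm has modulus `≤ D e^{2a}`.)  For (PL) this is the placement: with idea-1's leakage floor and
Slepian's asymptotics its scalar shadow is such a floor with `C = 4π`. -/
theorem signAware_two_of_windowFloor_sq {κ B C lam₀ : ℝ} (hκ : 0 < κ)
    (h : ∀ lam : ℝ, lam₀ ≤ lam → ∀ g : ℝ → ℂ, IsWeilTest g →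
      tsupport g ⊆ Icc (-Real.log lam) (Real.log lam) →
        κ * lam ^ (-B) * Real.exp (-C * lam ^ 2) * ∫ t : ℝ, ‖g t‖ ^ 2 ≤ (weilQuadratic g).re) :
    ∃ K a₀ : ℝ, ∀ a : ℝ, a₀ ≤ a →
      0 < weilGroundEnergy a ∧ Real.log (Real.log (weilGroundEnergy a)⁻¹) ≤ 2 * a + K := by
  obtain ⟨B₀, -, hB₀le⟩ := weilGroundEnergy_le_const
  set D : ℝ := |Real.log κ| + |B| + |C| + |Real.log B₀| + 1 with hD
  have hD1 : 1 ≤ D := by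
    rw [hD]
    linarith [abs_nonneg (Real.log κ), abs_nonneg B, abs_nonneg C, abs_nonneg (Real.log B₀)]
  refine ⟨Real.log D, max 1 (Real.log (max lam₀ 1)), fun a ha ↦ ?_⟩
  have ha1 : 1 ≤ a := le_trans (le_max_left _ _) ha
  set lam : ℝ := Real.exp a with hlam
  have hlampos : 0 < lam := Real.exp_pos a
  have hloglam : Real.log lam = a := Real.log_exp a
  have hlam₀ : lam₀ ≤ lam := by
    have h1 : Real.log (max lam₀ 1) ≤ a := le_trans (le_max_right _ _) ha
    have h2 : max lam₀ 1 ≤ lam := by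
      rw [hlam, ← Real.exp_log (lt_of_lt_of_le one_pos (le_max_right lam₀ 1))]
      exact Real.exp_le_exp.2 h1
    exact le_trans (le_max_left _ _) h2
  have hlam1 : 1 < lam := by
    have := Real.add_one_le_exp a
    rw [hlam]
    linarith
  -- the floor value at this window
  set φ : ℝ := κ * lam ^ (-B) * Real.exp (-C * lam ^ 2) with hφ
  have hrpow : 0 < lam ^ (-B) := Real.rpow_pos_of_pos hlampos _
  have hφpos : 0 < φ := mul_pos (mul_pos hκ hrpow) (Real.exp_pos _)
  have hφle : φ ≤ weilGroundEnergy a := by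
    have := le_weilGroundEnergy_of_windowDomination
      (Φ := fun lam g ↦ κ * lam ^ (-B) * Real.exp (-C * lam ^ 2) * ∫ t : ℝ, ‖g t‖ ^ 2)
      hlam1 (h lam hlam₀) (fun _ _ _ ↦ le_rfl)
    rwa [hloglam] at this
  have hεpos : 0 < weilGroundEnergy a := lt_of_lt_of_le hφpos hφle
  refine ⟨hεpos, ?_⟩
  -- `|log ε(a)| ≤ |log φ| + |log B₀| ≤ D·λ²`
  have hεle : weilGroundEnergy a ≤ B₀ := hB₀le a ha1
  have hB₀pos : 0 < B₀ := lt_of_lt_of_le hεpos hεle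
  have hlogφ : Real.log φ = Real.log κ + -B * a + -C * lam ^ 2 := by
    rw [hφ, Real.log_mul (mul_pos hκ hrpow).ne' (Real.exp_pos _).ne',
      Real.log_mul hκ.ne' hrpow.ne', Real.log_rpow hlampos, hloglam, Real.log_exp]
  have habsε : |Real.log (weilGroundEnergy a)| ≤ |Real.log φ| + |Real.log B₀| := by
    have h1 : Real.log φ ≤ Real.log (weilGroundEnergy a) := Real.log_le_log hφpos hφle
    have h2 : Real.log (weilGroundEnergy a) ≤ Real.log B₀ := Real.log_le_log hεpos hεle
    rw [abs_le]
    constructor <;> linarith [neg_abs_le (Real.log φ), le_abs_self (Real.log B₀),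
      abs_nonneg (Real.log φ), abs_nonneg (Real.log B₀)]
  have ha_le : a ≤ lam ^ 2 := by
    have h1 : a + 1 ≤ lam := by rw [hlam]; exact Real.add_one_le_exp a
    nlinarith
  have hone_le : 1 ≤ lam ^ 2 := by nlinarith
  have habsφ : |Real.log φ| ≤ (|Real.log κ| + |B| + |C|) * lam ^ 2 := by
    rw [hlogφ]
    have e0 : |Real.log κ + -B * a + -C * lam ^ 2| ≤ |Real.log κ| + |-B * a| + |-C * lam ^ 2| :=
      (abs_add_le _ _).trans (by linarith [abs_add_le (Real.log κ) (-B * a)])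
    have e1 : |-B * a| = |B| * a := by
      rw [abs_mul, abs_neg, abs_of_nonneg (by linarith : (0 : ℝ) ≤ a)]
    have e2 : |-C * lam ^ 2| = |C| * lam ^ 2 := by
      rw [abs_mul, abs_neg, abs_of_nonneg (by positivity : (0 : ℝ) ≤ lam ^ 2)]
    have e3 : |Real.log κ| ≤ |Real.log κ| * lam ^ 2 := le_mul_of_one_le_right (abs_nonneg _) hone_le
    have e4 : |B| * a ≤ |B| * lam ^ 2 := mul_le_mul_of_nonneg_left ha_le (abs_nonneg _)
    rw [e1, e2] at e0
    linarith
  have hM : |Real.log (weilGroundEnergy a)⁻¹| ≤ D * lam ^ 2 := by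
    rw [Real.log_inv, abs_neg]
    have e5 : |Real.log B₀| ≤ |Real.log B₀| * lam ^ 2 :=
      le_mul_of_one_le_right (abs_nonneg _) hone_le
    have e6 : (|Real.log κ| + |B| + |C|) * lam ^ 2 + |Real.log B₀| * lam ^ 2 ≤ D * lam ^ 2 := by
      rw [hD]; nlinarith
    linarith
  have hM1 : 1 ≤ D * lam ^ 2 := by nlinarith
  calc Real.log (Real.log (weilGroundEnergy a)⁻¹)
      ≤ Real.log (D * lam ^ 2) := HandoffLowerSlope.log_le_log_of_abs_le hM1 hM
    _ = 2 * a + Real.log D := by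
        rw [Real.log_mul (by positivity) (by positivity), Real.log_pow, hloglam]
        push_cast
        ring

/-- **Hence a Gaussian-floored domination law is `RH ∧ (the bare slope-2 law)`** — slope EXACTLY `2`
in file XVII's table (`signAware_lowerSlope_iff`): not refuted by `not_signAware_lowerSlope_of_lt_two`
(which kills every slope `< 2`), not a theorem past the absolute slope `A` either; the one open band.
This is where (PL) sits. -/
theorem riemannHypothesis_and_lowerSlope_two_of_windowFloor_sq {κ B C lam₀ : ℝ} (hκ : 0 < κ)
    (h : ∀ lam : ℝ, lam₀ ≤ lam → ∀ g : ℝ → ℂ, IsWeilTest g →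
      tsupport g ⊆ Icc (-Real.log lam) (Real.log lam) →
        κ * lam ^ (-B) * Real.exp (-C * lam ^ 2) * ∫ t : ℝ, ‖g t‖ ^ 2 ≤ (weilQuadratic g).re) :
    _root_.RiemannHypothesis ∧
      ∃ K a₀ : ℝ, ∀ a : ℝ, a₀ ≤ a →
        Real.log (Real.log (weilGroundEnergy a)⁻¹) ≤ 2 * a + K :=
  (HandoffLowerSlope.signAware_lowerSlope_iff 2).1 (signAware_two_of_windowFloor_sq hκ h)

end Scalar

end Summit.RiemannHypothesis.RiemannHypothesis.Theorems.HandoffDomination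

end
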